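import Summits.Schanuel.Schanuel.Theorems.RootDecomp1KSiegelFunctionsAll02

/-!
# RootDecomp1KSiegelFunctionsAll (part 03 of 03) — CENSUS PROVENANCE for lens-1 g71 NODE 31-G «SiegelFunctionsAll and the height binder HeightComparison PROVED hypothesis-free» (FLOOR G (a) of RULE K-R59 (ii); CLAIM 31-G L3188, NOTES L3189 / L3190 / L3193 (v3c digests of record); crit-1 (g13) VERDICT 31-G L3194: FLOOR G (a) CONTENT MET IN SCRATCH — THEOREM ×1 PAYABLE ON LANDING, PORT GO)

(census-1 g26 record port. SOURCE: the lens's standalone HOME/decomp-schanuel-lens-1/g71/out/SiegelFunctionsAll.lean v3c sha256 e1ade63183dfe401… (804 l; = PlanG b3685036… on top of the LANDED tree port RootDecomp1KSiegelFunctions01–09 = K 4f39c136…, PORT LANDED 31 L3184, PORT IDENTITY 31 L3187) split BY THE LENS into portG/RootDecomp1KSiegelFunctionsAll01 69e9e04cfd00… (341 l) / 02 444c4e5c0a50… (314 l) / 03 20ceda62193a… (213 l), cum 3340325d… rc 0 · 0 sorries (lens farm; NOTE L3193); the critic re-checked v3 / v3c rc 0 · 0 sorries, `--axioms` standard on the heads,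 CONTROL ControlG rc 1 as designed (VERDICT 31-G (i)–(v)). The census takes the three lens parts as the bodies (the nested sections PlanG ⊃ S5 ⊃ Main are re-opened per part by the lens; the `attribute [instance]` line on the bundled-structure fields CurveModel.instField / .instAlgebra / .instAFF in part 01 is the lens's — the gate routes it to review), adding this provenance block, one-line docstrings for undocumented helpers (part 01: 6; statements quoted), and THREE PORT-SIDE MODIFIERS OF RECORD asked for / forced by the gate: (m1) part 01 `curveModel_nonempty`: the DEPRECATED `IsLocalization.integerNormalization_map_to_map` replaced by `IsLocalization.integerNormalization_spec` (b : K[X] with b ∈ M; three tokens adapted; VERDICT 31-G PORT GO «fix the two lint warnings»); (m2) part 02 `mem_of_ord_nonneg`: `omit [IsAlgFunctionField K F] in` (unused section variable); (m3) `exists_map_eq_C_mul` PRIVATE in part 01 (dedup.landed dry-run notice ≡ `Literature.NumberTheory.LFunctions.WeilFatou.exists_int_map_eq_C_mul`) with a PRIVATE copy in part 02 for `integralDegreeBound`; everything else = the lens's parts VERBATIM. Chain 01 ← …RootDecomp1KSiegelFunctions09 + Literature…PlaneCurveFunctionFieldProofs / FunctionFieldGenusRatPlacesProofs / FunctionFieldGenusProofs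 / FunctionFieldGenusRiemannTheoremProofs + Mathlib.RingTheory.Spectrum.Maximal.Localization / Mathlib.RingTheory.DedekindDomain.IntegralClosure, 02 ← 01, 03 ← 02; ONE namespace Summit.Schanuel.Schanuel.Theorems.RootDecomp1KSiegelFunctions (the node-31 namespace, extended); `--supports stmt-Schanuel-33364` (item OPEN; the heads decide no ∀-item of the route). HEADS (part 03): `theorem siegelFunctionsAll : SiegelFunctionsAll` and `theorem heightComparison : RootDecomp1KHeightGrading.HeightComparison` — node 12's (β) print binder DISCHARGED in the tree, hypothesis-free — via S1/S6a `curveModel_nonempty` / `modelExists`, S2 `degYBound` (part 01), S5 `integralDegreeBound` (part 02: valuation-integrality + `minpoly_map_eq_of_forall_mem` + `scaleRoots` over K(x) = K(1/x) + transcendence degree count), S6b `qdvd_relPoly_of_rel`, S3/S4 by the Literature Riemann inequality `degree_add_one_sub_ell_le_genus_holds` BY NAME, the compositions `siegelFunctions_of_model` / `siegelFunctionsAll_of` / `siegelFunctionsAll_of_integralDegreeBound` / `heightComparison_of_integralDegreeBound`; the eight ×0 corollaries `heightComparisonAt_of_geomIrreducible`, `thinFibreAt_of_geomIrreducible` (node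 12's THEOREM A unconditional), `thinFibre_of_padicSubspace` (the K-line sector head with the height binder gone: PadicSubspace ∧ HeightOffAt m₀ ⇒ ThinFibre m₀), `b_of_padicSubspace`, `thinFibreAt_iff_levelFinite_of_lt` / `thinFibreAt_iff_bddLevelEmpty_of_lt` (THEOREM B unconditional), `thinFibreAt_grading_of_geomIrreducible`, `thinFibreAt_of_heightDecided`. VERDICT 31-G L3194 (crit-1 g13): «FLOOR G (a) CONTENT IS MET IN SCRATCH — THEOREM ×1 PAYABLE ON LANDING booked under RULE K-R59 (ii) for the registered contingent head heightComparison : HeightComparison (hypothesis-free)»; p2: the TALLY moves to lens-1 ×23 + THEOREM ×25 at the critic's PORT IDENTITY of the LANDED head (until then lens-1 ×22 + THEOREM ×24); p3 (automatic, ×0): the K-line (β)-binder DISCHARGED — antecedents left PadicSubspace ∧ HeightOffAt m₀; node 12's THEOREMS A / B unconditional; census LIVENESS-v50 re-points the 13 conditional rows of v49 to reached BY NAME. Nothing here proves Schanuel, 33364, 33363, 31077 or 31987; rung 0; the THEOREM ×1 of RULE K-R59 (ii) is paid at the critic's PORT IDENTITY 31-G, not by this file.)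
-/

/-!
# RootDecomp1KSiegelFunctionsAll03 — lens 1, generation 71, NODE 31-G «`SiegelFunctionsAll` and the height binder `HeightComparison`
PROVED hypothesis-free» (FLOOR G (a) CONTENT of VERDICT 31 L3175 / ACK L3183; CLAIM 31-G L3188): PlanG v3 (HOME
decomp-schanuel-lens-1/g71/out/PlanG.lean, 727 l, sorry-free) on top of the landed record port `RootDecomp1KSiegelFunctions01–09`
(K 4f39c136…), split in three parts `…SiegelFunctionsAll01–03` (01 = S1/S6a CONSTRUCTION `CurveModel`/`SiegelModel`, `modelExists`, S2
`degYBound`, the statements `ModelExists`/`DegYBound`/`IntegralDegreeBound`, clearing of denominators; 02 = S5 `integralDegreeBound`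
(valuation-integrality ⇒ `K[g]`-coefficients of the minimal polynomial, `scaleRoots` comparison over `K(x) = K(1/x)`, transcendence degree
count); 03 = S6b `qdvd_relPoly_of_rel`, S3/S4 by the Literature Riemann inequality BY NAME, the compositions, and the hypothesis-free heads
`theorem siegelFunctionsAll : SiegelFunctionsAll`, `theorem heightComparison : …RootDecomp1KHeightGrading.HeightComparison`).
ONE namespace `Summit.Schanuel.Schanuel.Theorems.RootDecomp1KSiegelFunctions`; hygiene as the K port (NODE-g71.md §3c (iv)); three
instance ATTRIBUTES on the bundled-structure fields `CurveModel.instField/.instAlgebra/.instAFF` (part 01).  — part 03: S6b, the compositions, the hypothesis-free heads, and the discharged consequences (`heightComparisonAt_of_geomIrreducible`, `thinFibreAt_of_geomIrreducible`, `thinFibre_of_padicSubspace`, `b_of_padicSubspace`).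
-/

noncomputable section

namespace Summit.Schanuel.Schanuel.Theorems.RootDecomp1KSiegelFunctions

open Polynomial
open scoped Nat
open Summit.Schanuel.Schanuel.Theorems.RootDecomp1KDegreeLadder (bev xdeg natDegree_coeff_le_xdeg ThinFibreAt ThinFibre
  thinFibreAt_of_natDegree_lt)
open Summit.Schanuel.Schanuel.Theorems.RootDecomp1KHeightGrading

open Literature.NumberTheory.DiophantineGeometry
open Literature.NumberTheory.DiophantineGeometry.AlgFunctionField
open scoped IntermediateField

/-- S6b (PROVED): an integral relation for `z = G/H` in the model gives `P_ℚ ∣ relPoly m D χ G H`. -/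
theorem qdvd_relPoly_of_rel {P : ℤ[X][X]} (M : SiegelModel P) {z : M.F} {G H : ℤ[X][X]}
    (hGH : z * aevalAeval M.x M.y (ratModel H) = aevalAeval M.x M.y (ratModel G)) {m : ℕ} {D : ℤ} {χ : ℕ → ℤ[X]}
    (hrel : (D : M.F) * z ^ m +
      ∑ i ∈ Finset.Icc 1 m, aeval M.x ((χ i).map (Int.castRingHom ℚ)) * z ^ (m - i) = 0) :
    QDvd P (relPoly m D χ G H) := by
  rw [QDvd, ← M.ker_iff]
  set e : ℚ[X][X] →ₐ[ℚ] M.F := aevalAeval M.x M.y with he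
  have hC : ∀ q : ℤ[X], e (ratModel (C q)) = aeval M.x (q.map (Int.castRingHom ℚ)) := by
    intro q
    rw [ratModel_C, he, aevalAeval_C]
  have hD : e (ratModel (C (C D))) = (D : M.F) := by
    rw [hC, Polynomial.map_C, aeval_C, eq_intCast, map_intCast]
  have hterm : ∀ i ∈ Finset.Icc 1 m,
      e (ratModel (C (χ i) * G ^ (m - i) * H ^ i)) =
        e (ratModel H) ^ m * (aeval M.x ((χ i).map (Int.castRingHom ℚ)) * z ^ (m - i)) := by
    intro i hi
    have him : i ≤ m := (Finset.mem_Icc.1 hi).2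
    rw [ratModel_mul, ratModel_mul, ratModel_pow, ratModel_pow, map_mul, map_mul, map_pow, map_pow, hC, ← hGH, mul_pow,
      show e (ratModel H) ^ m = e (ratModel H) ^ (m - i) * e (ratModel H) ^ i by
        rw [← pow_add, Nat.sub_add_cancel him]]
    ring
  have hsum : e (ratModel (relPoly m D χ G H)) =
      e (ratModel H) ^ m * ((D : M.F) * z ^ m +
        ∑ i ∈ Finset.Icc 1 m, aeval M.x ((χ i).map (Int.castRingHom ℚ)) * z ^ (m - i)) := by
    rw [relPoly, ratModel_add, ratModel_mul, ratModel_pow, ratModel_sum, map_add, map_mul, map_pow, map_sum, hD, ← hGH,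
      mul_pow, mul_add, Finset.mul_sum]
    congr 1
    · ring
    · exact Finset.sum_congr rfl fun i hi ↦ hterm i hi
  rw [hsum, hrel, mul_zero]

/-- COMPOSITION (sorry-free): a model with the S2 bound and the S5 integrality statement yields Siegel functions,
with `a := ⌈(b·k + g)/n⌉` and `c := g + n − 1`. -/
theorem siegelFunctions_of_model {P : ℤ[X][X]} (hk : 1 ≤ xdeg P) (hn : 1 ≤ P.natDegree) (M : SiegelModel P)
    (hdeg : Divisor.degree (principalDivisor ℚ M.y)⁻ ≤ (xdeg P : ℤ))
    (hS5 : ∀ (a : ℕ) (z : M.F), z ∈ riemannRochSpace (a • (principalDivisor ℚ M.x)⁻) →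
      ∃ (m : ℕ) (D : ℤ) (χ : ℕ → ℤ[X]), D ≠ 0 ∧ (∀ i, (χ i).natDegree ≤ a * i) ∧
        (D : M.F) * z ^ m + ∑ i ∈ Finset.Icc 1 m, aeval M.x ((χ i).map (Int.castRingHom ℚ)) * z ^ (m - i) = 0) :
    SiegelFunctions P := by
  classical
  have hy0 : M.y ≠ 0 := fun h ↦ M.transcendental_y hk (h ▸ isAlgebraic_zero)
  set n := P.natDegree with hn'
  set k := xdeg P with hk'
  set g := genus ℚ M.F with hg'
  refine ⟨g + n - 1, fun b hb ↦ ?_⟩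
  set a := (b * k + g + (n - 1)) / n with ha'
  have han : b * k + g ≤ a * n ∧ a * n ≤ b * k + (g + n - 1) := by
    have h1 := Nat.div_add_mod (b * k + g + (n - 1)) n
    have h2 := Nat.mod_lt (b * k + g + (n - 1)) (show 0 < n by omega)
    have h3 : a * n = n * ((b * k + g + (n - 1)) / n) := by rw [ha']; ring
    omega
  set Dx : Divisor ℚ M.F := (principalDivisor ℚ M.x)⁻ with hDx'
  set Dy : Divisor ℚ M.F := (principalDivisor ℚ M.y)⁻ with hDy'
  set D : Divisor ℚ M.F := a • Dx - b • Dy with hD'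
  have hDx : Divisor.degree Dx = n := by
    rw [hDx', degree_negPart_principalDivisor_eq (M.transcendental_x hn), M.finrank_eq, natDegree_ratModel]
  have hDy0 : 0 ≤ Dy := negPart_nonneg _
  have hdegD : Divisor.degree D = a * Divisor.degree Dx - b * Divisor.degree Dy := by
    rw [hD', map_sub, map_nsmul, map_nsmul, nsmul_eq_mul, nsmul_eq_mul]
  have hdegD' : (g : ℤ) ≤ Divisor.degree D := by
    rw [hdegD, hDx]
    have h1 : ((b * k + g : ℕ) : ℤ) ≤ ((a * n : ℕ) : ℤ) := by exact_mod_cast han.1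
    push_cast at h1
    have h2 : (b : ℤ) * Divisor.degree Dy ≤ b * k := by
      have := mul_le_mul_of_nonneg_left hdeg (show (0 : ℤ) ≤ b by positivity)
      simpa [hDy'] using this
    linarith
  have hR : Divisor.degree D + 1 - (ell D : ℤ) ≤ (genus ℚ M.F : ℤ) :=
    degree_add_one_sub_ell_le_genus_holds (K := ℚ) (F := M.F) D
  have hell : 0 < ell D := by
    have : (g : ℤ) = genus ℚ M.F := by rw [hg']
    omega
  obtain ⟨phi, hphiD, hphi0⟩ := exists_mem_ne_zero_of_ell_pos hell
  have hDle : D ≤ a • Dx := by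
    rw [hD']
    exact sub_le_self _ (nsmul_nonneg hDy0 b)
  have hphi : phi ∈ riemannRochSpace (a • Dx) := riemannRochSpace_mono hDle hphiD
  have hyb : M.y ^ b ∈ riemannRochSpace (b • Dy) :=
    pow_mem_riemannRochSpace_nsmul (mem_riemannRochSpace_negPart_principalDivisor (K := ℚ) hy0) b
  have hψ : phi * M.y ^ b ∈ riemannRochSpace (a • Dx) := by
    have := mul_mem_riemannRochSpace_add hphiD hyb
    simpa [hD'] using this
  obtain ⟨G, H, hH0, hGH⟩ := M.exists_frac_int phi
  obtain ⟨m, Dm, χ, hD0, hχ, hrel⟩ := hS5 a phi hphi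
  obtain ⟨m', Dm', χ', hD0', hχ', hrel'⟩ := hS5 a (phi * M.y ^ b) hψ
  have hGH' : phi * M.y ^ b * aevalAeval M.x M.y (ratModel H) = aevalAeval M.x M.y (ratModel (G * X ^ b)) := by
    rw [show ratModel (G * X ^ b) = ratModel G * X ^ b by
      rw [ratModel, ratModel, Polynomial.map_mul, Polynomial.map_pow, map_X], map_mul, map_pow, aevalAeval_Y, ← hGH]
    ring
  refine ⟨a, G, H, han.2, ?_, ?_, ⟨m, Dm, χ, hD0, hχ, qdvd_relPoly_of_rel M hGH hrel⟩,
    ⟨m', Dm', χ', hD0', hχ', qdvd_relPoly_of_rel M hGH' hrel'⟩⟩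
  · intro hG
    have h0 : aevalAeval M.x M.y (ratModel G) = 0 := (M.ker_iff _).2 hG
    rw [h0] at hGH
    exact hphi0 ((mul_eq_zero.1 hGH).resolve_right hH0)
  · intro hH
    exact hH0 ((M.ker_iff _).2 hH)

/-- COMPOSITION (sorry-free): the three statements S1+S6a, S2, S5 imply `SiegelFunctionsAll` (S1+S6a and S2 are theorems above). -/
theorem siegelFunctionsAll_of (h1 : ModelExists) (h2 : DegYBound) (h5 : IntegralDegreeBound) :
    SiegelFunctionsAll := by
  intro P hgi hk hn
  obtain ⟨M⟩ := h1 P hgi hk hn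
  exact siegelFunctions_of_model hk hn M (h2 P hk M) (fun a z hz ↦ h5 M.F M.x (M.transcendental_x hn) a z hz)

/-- … and hence node 12's binder `HeightComparison` (by `heightComparison_of_siegelFunctionsAll`). -/
theorem heightComparison_of_plan (h1 : ModelExists) (h2 : DegYBound) (h5 : IntegralDegreeBound) :
    Summit.Schanuel.Schanuel.Theorems.RootDecomp1KHeightGrading.HeightComparison :=
  heightComparison_of_siegelFunctionsAll (siegelFunctionsAll_of h1 h2 h5)

/-- **ONE-HYPOTHESIS REDUCTION (sorry-free):** the integrality/degree statement S5 alone implies `SiegelFunctionsAll`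
(S1+S6a `modelExists` and S2 `degYBound` are proved above). -/
theorem siegelFunctionsAll_of_integralDegreeBound (h5 : IntegralDegreeBound) : SiegelFunctionsAll :=
  siegelFunctionsAll_of modelExists degYBound h5

/-- … and hence the tree binder `HeightComparison` BY NAME. -/
theorem heightComparison_of_integralDegreeBound (h5 : IntegralDegreeBound) :
    Summit.Schanuel.Schanuel.Theorems.RootDecomp1KHeightGrading.HeightComparison :=
  heightComparison_of_plan modelExists degYBound h5

/-- **FLOOR G (a), content:** `SiegelFunctionsAll`, hypothesis-free (S1–S6 all proved in this section). -/
theorem siegelFunctionsAll : SiegelFunctionsAll :=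
  siegelFunctionsAll_of modelExists degYBound integralDegreeBound

/-- **FLOOR G (a), content:** the tree binder `HeightComparison` BY NAME, hypothesis-free
(`= heightComparison_of_siegelFunctionsAll siegelFunctionsAll` of the K file). -/
theorem heightComparison : Summit.Schanuel.Schanuel.Theorems.RootDecomp1KHeightGrading.HeightComparison :=
  heightComparison_of_integralDegreeBound integralDegreeBound

/-! #### Consequences, hypothesis-free (the height binder DISCHARGED) -/

/-- `HeightComparisonAt P` for every geometrically irreducible `P` with `xdeg P, deg_Y P ≥ 1` — unconditionally. -/
theorem heightComparisonAt_of_geomIrreducible (P : ℤ[X][X]) (hgi : GeomIrreducible P) (hk : 1 ≤ xdeg P)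
    (hn : 1 ≤ P.natDegree) : HeightComparisonAt P :=
  heightComparison_iff.1 heightComparison P hgi hk hn

/-- node 12's THEOREM A, now UNCONDITIONAL: thin fibres at every level `m₀` with `deg_Y P < m₀ · xdeg P` for every geometrically
irreducible `P` with `1 ≤ xdeg P` (`= thinFibreAt_of_heightComparison heightComparison`). -/
theorem thinFibreAt_of_geomIrreducible {P : ℤ[X][X]} (hgi : GeomIrreducible P) (hk : 1 ≤ xdeg P) {m₀ : ℕ}
    (hlt : P.natDegree < m₀ * xdeg P) : ThinFibreAt m₀ P :=
  thinFibreAt_of_heightComparison heightComparison hgi hk hlt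

/-- the K-line sector head with the height binder discharged: `PadicSubspace ∧ HeightOffAt m₀ ⇒ ThinFibre m₀` (`m₀ ≥ 2`). -/
theorem thinFibre_of_padicSubspace {m₀ : ℕ} (hm : 2 ≤ m₀)
    (hS : Summit.Schanuel.Schanuel.Theorems.RootDecomp1KSubspaceBranch.PadicSubspace) (hR : HeightOffAt m₀) :
    ThinFibre m₀ :=
  thinFibre_of_padicSubspace_siegelFunctionsAll hm hS siegelFunctionsAll hR

/-- … and its (b)-form: `PadicSubspace ∧ HeightOffAt m₀ ∧ SkelLiouvilleFix m₀ ρ ⇒ {L₂, ρ}` algebraically independent. -/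
theorem b_of_padicSubspace {m₀ : ℕ} (hm : 2 ≤ m₀)
    (hS : Summit.Schanuel.Schanuel.Theorems.RootDecomp1KSubspaceBranch.PadicSubspace) (hR : HeightOffAt m₀) (ρ : ℝ)
    (hρ : Summit.Schanuel.Schanuel.Theorems.RootDecomp1KSkelCell.SkelLiouvilleFix m₀ ρ) :
    AlgebraicIndependent ℚ ![((liouvilleNumber 2 : ℝ) : ℂ), (ρ : ℂ)] :=
  b_of_padicSubspace_siegelFunctionsAll hm hS siegelFunctionsAll hR ρ hρ

/-- node 12's THEOREM B, now UNCONDITIONAL: above the boundary (`m₀ · xdeg P < deg_Y P`) the thin-fibre clause at `m₀` IS the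
finiteness of the levels (`LevelFinite P`) — `= thinFibreAt_iff_levelFinite_of_heightComparison heightComparison`. -/
theorem thinFibreAt_iff_levelFinite_of_lt {P : ℤ[X][X]} (hgi : GeomIrreducible P) (hk : 1 ≤ xdeg P) {m₀ : ℕ}
    (hm : 1 ≤ m₀) (hlt : m₀ * xdeg P < P.natDegree) :
    ThinFibreAt m₀ P ↔ Summit.Schanuel.Schanuel.Theorems.RootDecomp1KLevelFinite.LevelFinite P :=
  thinFibreAt_iff_levelFinite_of_heightComparison heightComparison hgi hk hm hlt

/-- … and with the bounded-level form `BddLevelEmpty P`. -/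
theorem thinFibreAt_iff_bddLevelEmpty_of_lt {P : ℤ[X][X]} (hgi : GeomIrreducible P) (hk : 1 ≤ xdeg P) {m₀ : ℕ}
    (hm : 1 ≤ m₀) (hlt : m₀ * xdeg P < P.natDegree) : ThinFibreAt m₀ P ↔ BddLevelEmpty P :=
  thinFibreAt_iff_bddLevelEmpty_of_heightComparison heightComparison hgi hk hm hlt

/-- the height GRADING of the clause, unconditional (`= thinFibreAt_grading heightComparison`). -/
theorem thinFibreAt_grading_of_geomIrreducible {P : ℤ[X][X]} (hgi : GeomIrreducible P) (hk : 1 ≤ xdeg P) {m₀ : ℕ}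
    (hm : 1 ≤ m₀) :
    (P.natDegree < m₀ * xdeg P → ThinFibreAt m₀ P) ∧ (m₀ * xdeg P < P.natDegree → (ThinFibreAt m₀ P ↔ BddLevelEmpty P)) :=
  thinFibreAt_grading heightComparison hgi hk hm

/-- the class `HeightDecidedAt m₀` is decided, unconditionally (`= thinFibreAt_of_heightDecidedAt heightComparison`). -/
theorem thinFibreAt_of_heightDecided {m₀ : ℕ} {P : ℤ[X][X]} (h : HeightDecidedAt m₀ P) : ThinFibreAt m₀ P :=
  thinFibreAt_of_heightDecidedAt heightComparison h

end Summit.Schanuel.Schanuel.Theorems.RootDecomp1KSiegelFunctions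

end
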